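import Summits.QuantumFields.BalabanUV.T4Continuum.Support.VariationalEffectiveHilbert
import Summits.QuantumFields.BalabanUV.T4Continuum.Support.VectorLineTransport

/-!
# T⁴ programme, spine node NE2 (U1a), lane P2 — SUPPLIER ITEM «D-E», part 3: THE VECTOR CANONICAL PAIR AT A GENERAL HILBERT SPACE `E` HAS AN
# EFFECTIVE OPERATOR — leaf D for E-valued 1-forms (`VariationalVectorForm` p216339 + leaf-03-g4's line average `QvL`, `VectorLineTransport`)
# by the flattening of part 1 on the product carrier `Tor × Fin d → E`, and its η-rate currency modulo the vector brackets

NE2 formalisation swarm `b2b-balaban-t4-ne2-formalise-*`, leaf prover 02 (gen 4); journal INTENT «D-E» (CLAIMS.log 2026-08-20T13:58Z).  The retired road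
owner's `VariationalVectorEffective` (p216485) does this at `E = ℂ`; here `E` is any finite-dimensional complex Hilbert space with an orthonormal basis
`b : OrthonormalBasis κ ℂ E` (e.g. `stdOrthonormalBasis`), the bond transports `R : Tor → Fin d → (E →L[ℂ] E)` and line transports
`T : Tor M → (Fin d → Fin n) → Fin n → Fin d → (E →L[ℂ] E)` are DATA:
 * §1 product-index presentation `uncV`∕`curV`; **`QvLLin`** (the line average IS ℂ-linear), **`curlLinE`** (the covariant curl IS ℂ-linear), `curlSq_eq_sum`;
   the PSD matrix **`KVE R Gm b := (n²∕n^d) • (½·Gram(matE b curlLinE) + Gm)`** and **`ScV_eq_qformE`**: `ScV R G (curV w) = qform (KVE R Gm b) (flatE b w)`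
   whenever the DATA gauge∕curvature functional is a matrix form `G W = qform Gm (flatE b (uncV W))`;
 * §2 **`blockSpin_ScV_eqE`**: under leaf V-P's shape `qWV W ≤ C_P·(ScV R G W + nsqV (QvL T W))` and `QvL T` onto,
   `blockSpin (QvL n M T) (ScV n M R G) φ = re⟨flatE b (uncV φ), effVE · flatE b (uncV φ)⟩`, `effVE` HERMITIAN on `(Tor M × Fin d) × κ`;
 * §3 **`towerLimitRate_effVE`**: along `n_k = L^k`, V-P coercivity per level + the two one-sided brackets of `vector_pair_bracket_sqrt` with defects
   `≤ C·ρ^k` ⟹ `TowerLimitRate (fun _ ↦ 1) 1 (k ↦ effVE (L^k) M (R k) (Gm k) (T k) b a) C ρ` — row NE2's currency for the E-VALUED vector species MODULO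
   the vector leaves (exactly `towerLimitRate_effV`'s `hbr` shape with `QvL` carriers and one index more).

HONEST FRAMING (T4-DAG p. 1).  Model level (transports, `G`, line transports DATA — c5); [folklore] linear algebra; data `def`s `uncV`, `curV`, `QvLLin`,
`curlLinE`, `KVE`, `effVE` only, no `def … : Prop`, no `sorry`; axioms standard.  Nothing of NE2 is proved here: coercivity, surjectivity and the brackets are
HYPOTHESES.  NE2 NOT proved; spine PROVED 0∕9; rung (B)+1 finite T⁴ — NOT infinite volume, NOT a mass gap, NOT Clay.  HONEST DEPENDENCY (cell, verbatim):
continuum YM on T⁴ ⇐ BetaPertH ∧ nine spine estimates (0/9 proved); BetaPertH ⇐ (D1) ∧ (D4) ∧ CAP+tail; G-an2-4 gates asym, D1 and NE2/3/4.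
-/

noncomputable section

namespace Summit.QuantumFields.BalabanUV.T4Continuum.VariationalEffectiveHilbertVector

open Finset
open scoped Matrix ComplexConjugate ComplexOrder Matrix.Norms.L2Operator BigOperators InnerProductSpace
open Literature.MathematicalPhysics.QuantumFieldTheory.Balaban1983to89
open Literature.MathematicalPhysics.QuantumFieldTheory.Balaban1983to89.B5Prop11Plancherel (Tor fine unitVec)
open Literature.MathematicalPhysics.QuantumFieldTheory.Balaban1983to89.B5Block118 (tstep bpt)
open Literature.MathematicalPhysics.QuantumFieldTheory.Balaban1983to89.B5Prop11Lower (nsq nsq_nonneg)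
open Literature.Analysis.Complex (qform qform_add qform_smul qform_nonneg_of_posSemidef)
open Summit.QuantumFields.BalabanUV.T4Continuum.VariationalTransfer (blockSpin)
open Summit.QuantumFields.BalabanUV.T4Continuum.VariationalEffectiveOperator (effOp)
open Summit.QuantumFields.BalabanUV.T4Continuum.VariationalVectorEffective (blockSpin_relabel)
open Summit.QuantumFields.BalabanUV.T4Continuum.CovariantAveragingTower (TowerLimitRate)
open Summit.QuantumFields.BalabanUV.T4Continuum.VectorBlockTrialForm (nsqV nsqV_nonneg QvL)
open Summit.QuantumFields.BalabanUV.T4Continuum.VariationalVectorForm (curlV curlSq ScV qWV)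
open Summit.QuantumFields.BalabanUV.T4Continuum.VariationalEffectiveHilbert

variable {d : ℕ} {E : Type*} [NormedAddCommGroup E] [InnerProductSpace ℂ E]
variable {κ : Type*} [Fintype κ] [DecidableEq κ]

/-! ## §1 Product-index presentation; the vector carriers are linear; the vector form is a matrix form after flattening -/

section Linear

/-- a 1-form as a function on the product index. [folklore] -/
def uncV {α β : Type*} (W : α → Fin d → β) : α × Fin d → β := fun p => W p.1 p.2

/-- … and back. [folklore] -/
def curV {α β : Type*} (w : α × Fin d → β) : α → Fin d → β := fun a μ => w (a, μ)

/-- `curV ∘ uncV = id`. [folklore] -/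
@[simp] theorem curV_uncV {α β : Type*} (W : α → Fin d → β) : curV (uncV W) = W := rfl

/-- `uncV ∘ curV = id`. [folklore] -/
@[simp] theorem uncV_curV {α β : Type*} (w : α × Fin d → β) : uncV (curV w) = w := rfl

/-- the (un)currying equivalence of carriers. [folklore] -/
def ucEquivV (α β : Type*) : (α → Fin d → β) ≃ (α × Fin d → β) := ⟨uncV, curV, fun _ => rfl, fun _ => rfl⟩

/-- `Σ_p ‖w p‖² = nsqV (curV w)`. [folklore] -/
theorem sum_norm_sq_eq_nsqV {β : Type*} [NormedAddCommGroup β] {N : Fin d → ℕ} [∀ μ, NeZero (N μ)] (w : Tor N × Fin d → β) :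
    ∑ p, ‖w p‖ ^ 2 = nsqV N (curV w) := by
  rw [nsqV, Fintype.sum_prod_type]; rfl

variable (n : ℕ) [NeZero n] (M : Fin d → ℕ) [hM : ∀ μ, NeZero (M μ)]

/-- **the line-sum average IS ℂ-linear** (product-index presentation of leaf-03-g4's `QvL`). [folklore] -/
def QvLLin (T : Tor M → (Fin d → Fin n) → Fin n → Fin d → (E →L[ℂ] E)) : (Tor (fine n M) × Fin d → E) →ₗ[ℂ] (Tor M × Fin d → E) where
  toFun w p := QvL n M T (curV w) p.1 p.2
  map_add' w w' := by
    funext p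
    simp only [QvL, curV, Pi.add_apply, map_add, Finset.sum_add_distrib, smul_add]
  map_smul' c w := by
    funext p
    simp only [QvL, curV, Pi.smul_apply, map_smul, RingHom.id_apply, ← Finset.smul_sum, smul_comm c]

omit [NeZero n] hM in
/-- `QvLLin` acts as `uncV ∘ QvL ∘ curV`. [folklore] -/
theorem QvLLin_apply (T : Tor M → (Fin d → Fin n) → Fin n → Fin d → (E →L[ℂ] E)) (w : Tor (fine n M) × Fin d → E) :
    QvLLin n M T w = uncV (QvL n M T (curV w)) := rfl

omit [NeZero n] hM in
/-- an onto line average has an onto product-index presentation. [folklore] -/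
theorem QvLLin_surjective {T : Tor M → (Fin d → Fin n) → Fin n → Fin d → (E →L[ℂ] E)} (hQ : Function.Surjective (QvL n M T)) :
    Function.Surjective (QvLLin n M T : (Tor (fine n M) × Fin d → E) →ₗ[ℂ] (Tor M × Fin d → E)) := by
  intro ψ
  obtain ⟨W, hW⟩ := hQ (curV ψ)
  exact ⟨uncV W, by rw [QvLLin_apply, curV_uncV, hW, uncV_curV]⟩

variable (N : Fin d → ℕ) [∀ μ, NeZero (N μ)]

omit [NeZero n] hM in
/-- **the covariant curl IS ℂ-linear** into `Tor × Fin d × Fin d`-indexed fields. [folklore] -/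
def curlLinE (R : Tor N → Fin d → (E →L[ℂ] E)) : (Tor N × Fin d → E) →ₗ[ℂ] (Tor N × (Fin d × Fin d) → E) where
  toFun w q := curlV N R (curV w) q.1 q.2.1 q.2.2
  map_add' w w' := by
    funext q
    simp only [curlV, VariationalVectorForm.cdV, curV, Pi.add_apply, map_add]
    abel
  map_smul' c w := by
    funext q
    simp only [curlV, VariationalVectorForm.cdV, curV, Pi.smul_apply, map_smul, RingHom.id_apply, smul_sub]

omit [NeZero n] hM in
/-- `curlSq R (curV w) = Σ_q ‖curlLinE R w q‖²`. [folklore] -/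
theorem curlSq_eq_sum (R : Tor N → Fin d → (E →L[ℂ] E)) (w : Tor N × Fin d → E) :
    curlSq N R (curV w) = ∑ q : Tor N × (Fin d × Fin d), ‖curlLinE N R w q‖ ^ 2 := by
  rw [curlSq, Fintype.sum_prod_type]
  refine Finset.sum_congr rfl fun x _ => ?_
  rw [Fintype.sum_prod_type]
  rfl

/-- **THE MATRIX OF THE VECTOR FORM AT GENERAL `E`**: `KVE R Gm b := (n²∕n^d) • (½·Gram(matE b (curlLinE R)) + Gm)`. [folklore] -/
def KVE (R : Tor (fine n M) → Fin d → (E →L[ℂ] E)) (Gm : Matrix ((Tor (fine n M) × Fin d) × κ) ((Tor (fine n M) × Fin d) × κ) ℂ)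
    (b : OrthonormalBasis κ ℂ E) : Matrix ((Tor (fine n M) × Fin d) × κ) ((Tor (fine n M) × Fin d) × κ) ℂ :=
  (((n : ℝ) ^ 2 / (n : ℝ) ^ d : ℝ) : ℂ) •
    ((((1 : ℝ) / 2 : ℝ) : ℂ) • ((matE b (curlLinE (fine n M) R))ᴴ * matE b (curlLinE (fine n M) R)) + Gm)

/-- `KVE` is positive semidefinite when `Gm` is. [folklore] -/
theorem KVE_posSemidef (R : Tor (fine n M) → Fin d → (E →L[ℂ] E)) {Gm : Matrix ((Tor (fine n M) × Fin d) × κ) ((Tor (fine n M) × Fin d) × κ) ℂ}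
    (hGm : Gm.PosSemidef) (b : OrthonormalBasis κ ℂ E) : (KVE n M R Gm b).PosSemidef := by
  unfold KVE
  refine Matrix.PosSemidef.smul ?_ (Complex.zero_le_real.mpr (by positivity))
  exact (Matrix.PosSemidef.smul (Matrix.posSemidef_conjTranspose_mul_self _) (Complex.zero_le_real.mpr (by positivity))).add hGm

/-- **`ScV ∘ curV = qform KVE ∘ flatE b`** when the gauge∕curvature functional is a matrix form of the flattened field. [folklore] -/
theorem ScV_eq_qformE (R : Tor (fine n M) → Fin d → (E →L[ℂ] E)) {Gm : Matrix ((Tor (fine n M) × Fin d) × κ) ((Tor (fine n M) × Fin d) × κ) ℂ}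
    {G : (Tor (fine n M) → Fin d → E) → ℝ} (b : OrthonormalBasis κ ℂ E) (hG : ∀ W, G W = qform Gm (flatE b (uncV W)))
    (w : Tor (fine n M) × Fin d → E) : ScV n M R G (curV w) = qform (KVE n M R Gm b) (flatE b w) := by
  rw [ScV, hG, uncV_curV, KVE, qform_smul, qform_add, qform_smul, ← sum_norm_sq_eq_qform_gram, ← curlSq_eq_sum]
  rw [div_eq_mul_inv]
  ring

/-- leaf V-P's shape gives the coercivity of part 1 §3 for `(QvLLin, ScV ∘ curV)` with `C₁ = C₂ = n^d·C_P`. [folklore] -/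
theorem coercive_of_vectorP {R : Tor (fine n M) → Fin d → (E →L[ℂ] E)} {G : (Tor (fine n M) → Fin d → E) → ℝ}
    {T : Tor M → (Fin d → Fin n) → Fin n → Fin d → (E →L[ℂ] E)} {CP : ℝ}
    (hP : ∀ W, qWV n M W ≤ CP * (ScV n M R G W + nsqV M (QvL n M T W))) (w : Tor (fine n M) × Fin d → E) :
    ∑ p, ‖w p‖ ^ 2 ≤ (n : ℝ) ^ d * CP * ∑ p', ‖QvLLin n M T w p'‖ ^ 2 + (n : ℝ) ^ d * CP * ScV n M R G (curV w) := by
  have hn : (0 : ℝ) < (n : ℝ) ^ d := by have := NeZero.ne n; positivity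
  have h := mul_le_mul_of_nonneg_left (hP (curV w)) hn.le
  unfold qWV at h
  rw [← mul_assoc, mul_inv_cancel₀ hn.ne', one_mul, ← sum_norm_sq_eq_nsqV] at h
  have e : (n : ℝ) ^ d * (CP * (ScV n M R G (curV w) + nsqV M (QvL n M T (curV w))))
      = (n : ℝ) ^ d * CP * ∑ p', ‖QvLLin n M T w p'‖ ^ 2 + (n : ℝ) ^ d * CP * ScV n M R G (curV w) := by
    rw [show nsqV M (QvL n M T (curV w)) = ∑ p', ‖QvLLin n M T w p'‖ ^ 2 from by
      rw [← curV_uncV (QvL n M T (curV w)), ← sum_norm_sq_eq_nsqV]; rfl]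
    ring
  rw [← e]
  exact h


/-- **THE VECTOR EFFECTIVE OPERATOR AT GENERAL `E`** on the flattened unit index `(Tor M × Fin d) × κ`. [folklore] -/
def effVE (R : Tor (fine n M) → Fin d → (E →L[ℂ] E)) (Gm : Matrix ((Tor (fine n M) × Fin d) × κ) ((Tor (fine n M) × Fin d) × κ) ℂ)
    (T : Tor M → (Fin d → Fin n) → Fin n → Fin d → (E →L[ℂ] E)) (b : OrthonormalBasis κ ℂ E) (a : ℝ) :
    Matrix ((Tor M × Fin d) × κ) ((Tor M × Fin d) × κ) ℂ :=
  effOp (KVE n M R Gm b) (matE b (QvLLin n M T)) a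

/-! ## §2 The vector block-spin value at general `E` is the form of `effVE` -/

/-- the curried and the product-index presentations have the same block-spin value. [folklore] -/
theorem blockSpin_uncV (R : Tor (fine n M) → Fin d → (E →L[ℂ] E)) (G : (Tor (fine n M) → Fin d → E) → ℝ)
    (T : Tor M → (Fin d → Fin n) → Fin n → Fin d → (E →L[ℂ] E)) (φ : Tor M → Fin d → E) :
    blockSpin (QvLLin n M T) (fun w => ScV n M R G (curV w)) (uncV φ) = blockSpin (QvL n M T) (ScV n M R G) φ :=
  blockSpin_relabel (ucEquivV (Tor (fine n M)) E) (ucEquivV (Tor M) E) (Q := QvL n M T) (Q' := QvLLin n M T) (S := ScV n M R G)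
    (S' := fun w => ScV n M R G (curV w)) (fun _ => rfl) (fun _ => rfl) φ

/-- **LEAF D FOR THE VECTOR PAIR AT GENERAL `E`**: under `QvL T` onto, `Gm` PSD with `G = qform Gm ∘ flatE b ∘ uncV`, and leaf V-P's shape,
`blockSpin (QvL n M T) (ScV n M R G) φ = re⟨flatE b (uncV φ), effVE · flatE b (uncV φ)⟩` (any `a > 0`). [folklore] -/
theorem blockSpin_ScV_eqE {R : Tor (fine n M) → Fin d → (E →L[ℂ] E)} {Gm : Matrix ((Tor (fine n M) × Fin d) × κ) ((Tor (fine n M) × Fin d) × κ) ℂ}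
    (hGm : Gm.PosSemidef) {G : (Tor (fine n M) → Fin d → E) → ℝ} (b : OrthonormalBasis κ ℂ E) (hG : ∀ W, G W = qform Gm (flatE b (uncV W)))
    {T : Tor M → (Fin d → Fin n) → Fin n → Fin d → (E →L[ℂ] E)} (hQ : Function.Surjective (QvL n M T)) {CP : ℝ}
    (hP : ∀ W, qWV n M W ≤ CP * (ScV n M R G W + nsqV M (QvL n M T W))) {a : ℝ} (ha : 0 < a) (φ : Tor M → Fin d → E) :
    blockSpin (QvL n M T) (ScV n M R G) φ = (star (flatE b (uncV φ)) ⬝ᵥ (effVE n M R Gm T b a *ᵥ flatE b (uncV φ))).re := by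
  rw [← blockSpin_uncV n M R G T φ]
  exact blockSpin_eq_effE b (Q := QvLLin n M T) (QvLLin_surjective n M hQ) (KVE_posSemidef n M R hGm b)
    (S := fun w => ScV n M R G (curV w)) (ScV_eq_qformE n M R b hG) (coercive_of_vectorP n M hP) ha (uncV φ)

/-- `effVE` is Hermitian. [folklore] -/
theorem effVE_isHermitian {R : Tor (fine n M) → Fin d → (E →L[ℂ] E)} {Gm : Matrix ((Tor (fine n M) × Fin d) × κ) ((Tor (fine n M) × Fin d) × κ) ℂ}
    (hGm : Gm.PosSemidef) {G : (Tor (fine n M) → Fin d → E) → ℝ} (b : OrthonormalBasis κ ℂ E) (hG : ∀ W, G W = qform Gm (flatE b (uncV W)))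
    {T : Tor M → (Fin d → Fin n) → Fin n → Fin d → (E →L[ℂ] E)} (hQ : Function.Surjective (QvL n M T)) {CP : ℝ}
    (hP : ∀ W, qWV n M W ≤ CP * (ScV n M R G W + nsqV M (QvL n M T W))) {a : ℝ} (ha : 0 < a) :
    (effVE n M R Gm T b a).IsHermitian :=
  effE_isHermitian b (Q := QvLLin n M T) (QvLLin_surjective n M hQ) (KVE_posSemidef n M R hGm b)
    (S := fun w => ScV n M R G (curV w)) (ScV_eq_qformE n M R b hG) (coercive_of_vectorP n M hP) ha

end Linear

/-! ## §3 The vector tower at general `E`: row NE2's η-rate currency modulo the vector brackets -/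

section Tower

variable (L : ℕ) [NeZero L] (M : Fin d → ℕ) [hM : ∀ μ, NeZero (M μ)]
variable (R : (k : ℕ) → Tor (fine (L ^ k) M) → Fin d → (E →L[ℂ] E))
variable (Gm : (k : ℕ) → Matrix ((Tor (fine (L ^ k) M) × Fin d) × κ) ((Tor (fine (L ^ k) M) × Fin d) × κ) ℂ)
variable (G : (k : ℕ) → (Tor (fine (L ^ k) M) → Fin d → E) → ℝ)
variable (T : (k : ℕ) → Tor M → (Fin d → Fin (L ^ k)) → Fin (L ^ k) → Fin d → (E →L[ℂ] E))

/-- **ROW NE2's η-RATE CURRENCY FOR THE E-VALUED VECTOR SPECIES, MODULO THE VECTOR BRACKETS**: along `n_k = L^k` with data `(R k, Gm k, T k)`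
(`G k = qform (Gm k) ∘ flatE b ∘ uncV`, `Gm k` PSD, `QvL (T k)` onto), leaf-V-P-shaped coercivity at every level and the two one-sided additive brackets between
consecutive vector block-spin values with defects `≤ C·ρ^k`, `ρ < 1` ⟹ `TowerLimitRate (fun _ ↦ 1) 1 (k ↦ effVE (L^k) M (R k) (Gm k) (T k) b a) C ρ`
on `(Tor M × Fin d) × κ`. [folklore] -/
theorem towerLimitRate_effVE (b : OrthonormalBasis κ ℂ E) (hGm : ∀ k, (Gm k).PosSemidef)
    (hG : ∀ k W, G k W = qform (Gm k) (flatE b (uncV W))) (hQ : ∀ k, Function.Surjective (QvL (L ^ k) M (T k))) {CP : ℕ → ℝ}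
    (hP : ∀ k W, qWV (L ^ k) M W ≤ CP k * (ScV (L ^ k) M (R k) (G k) W + nsqV M (QvL (L ^ k) M (T k) W)))
    {a : ℝ} (ha : 0 < a) {C ρ : ℝ} (hC : 0 ≤ C) (hρ : 0 ≤ ρ) (hρ1 : ρ < 1) (e e' : ℕ → ℝ) (he : ∀ k, e k ≤ C * ρ ^ k)
    (he' : ∀ k, e' k ≤ C * ρ ^ k)
    (hbr : ∀ k (φ : Tor M → Fin d → E),
      blockSpin (QvL (L ^ k) M (T k)) (ScV (L ^ k) M (R k) (G k)) φ
          ≤ blockSpin (QvL (L ^ (k + 1)) M (T (k + 1))) (ScV (L ^ (k + 1)) M (R (k + 1)) (G (k + 1))) φ + e k * nsqV M φ ∧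
        blockSpin (QvL (L ^ (k + 1)) M (T (k + 1))) (ScV (L ^ (k + 1)) M (R (k + 1)) (G (k + 1))) φ
          ≤ blockSpin (QvL (L ^ k) M (T k)) (ScV (L ^ k) M (R k) (G k)) φ + e' k * nsqV M φ) :
    TowerLimitRate (ι := fun _ => (Tor M × Fin d) × κ) (fun _ => (1 : Matrix ((Tor M × Fin d) × κ) ((Tor M × Fin d) × κ) ℂ)) 1
      (fun k => effVE (L ^ k) M (R k) (Gm k) (T k) b a) C ρ := by
  refine towerLimitRate_effE b (fun k => QvLLin (L ^ k) M (T k)) (fun k => KVE (L ^ k) M (R k) (Gm k) b)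
    (fun k w => ScV (L ^ k) M (R k) (G k) (curV w)) (fun k => QvLLin_surjective (L ^ k) M (hQ k))
    (fun k => KVE_posSemidef (L ^ k) M (R k) (hGm k) b) (fun k w => ScV_eq_qformE (L ^ k) M (R k) b (hG k) w)
    (fun k w => coercive_of_vectorP (L ^ k) M (hP k) w) ha hC hρ hρ1 e e' he he' fun k ψ => ?_
  have h1 : ∀ k, blockSpin (QvLLin (L ^ k) M (T k)) (fun w => ScV (L ^ k) M (R k) (G k) (curV w)) ψ
      = blockSpin (QvL (L ^ k) M (T k)) (ScV (L ^ k) M (R k) (G k)) (curV ψ) := fun k => by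
    rw [← blockSpin_uncV (L ^ k) M (R k) (G k) (T k) (curV ψ), uncV_curV]
  have h2 : ∑ p, ‖ψ p‖ ^ 2 = nsqV M (curV ψ) := sum_norm_sq_eq_nsqV ψ
  rw [h1 k, h1 (k + 1), h2]
  exact hbr k (curV ψ)

end Tower

end Summit.QuantumFields.BalabanUV.T4Continuum.VariationalEffectiveHilbertVector

end
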